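import Summits.CriticalPhenomena.CardyFormulaZ2.Theorems.CardyFlipRussoVoronoiHubFromSmirnovDefs
import Literature.Topology.PlaneTopology.ConnectedImKleinen
import Literature.Topology.PlaneTopology.UniformLocalConnectedness
import HarnessLib

/-!
# Components of a closed Jordan disc cut by convex bodies are connected im kleinen (stub `stub_componentsCIK`)

Helper file `--supports stmt-CriticalPhenomena-6433` (line `moebius-exact-delaunay-dilation-ward`,
stub S0′b `stub_componentsCIK` of the crux `VoronoiHubFromSmirnov`).  For a Jordan domain `Ω` and a
finite family `𝒞` of closed convex sets, every connected component `M` of `K = closure Ω ∩ ⋃₀ 𝒞`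
is connected im kleinen (`Literature.Topology.PlaneTopology.IsCIKAt`) at each of its points (`K`
itself need not be locally connected: `∂Ω` may touch an edge of a cell in a Cantor set).

Proof (Whyburn, *Analytic Topology* I §12, convergence continuum, plus two plane-geometric facts).
If `M` is not connected im kleinen at `y` with bad radius `ε`, `e = ε / 2`, `F = M ∩ B̄(y, e)`:
points `yₖ → y` of `M` lie outside the component `comp` of `y` in `M ∩ B(y, ε)`; their components
`Qₖ` in `F` consist of such bad points and reach the sphere `S(y, e)` (boundary bumping), so
`N = Ls Qₖ` is a non-degenerate continuum through `y` inside the component `C_y` of `y` in `F`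
(`isPreconnected_seqLimsup`).  KEY: no preconnected `S ⊆ K ∩ B(y, ε)` joins a point of `C_y` to a
bad point (else `S ∪ C_y ⊆ comp`).  Hence (1) `N ∩ Ω = ∅`, because at `u ∈ Ω ∩ ⋃₀ 𝒞` the set `K`
is connected im kleinen (`isCIKAt_inter_sUnion_of_mem`: near `u` only cells containing `u` are met,
so `K` is star-shaped about `u` locally); (2) `N ⊆ ∂Ω` is a non-degenerate sub-continuum of the
Jordan curve, hence `∂Ω ∩ B(m, r) ⊆ N` for some `m ∈ N`, `r > 0`
(`exists_ball_inter_frontier_subset`); (3) a bad point `q ∈ Qₖ` close to `m` is off `∂Ω`, so in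
`Ω`, and in a cell `C' ∋ m`; the segment `[q, m] ⊆ C'` first leaves `Ω` at a point
`m' ∈ ∂Ω ∩ B(m, r) ⊆ N ⊆ C_y` (`segment_exists_first_exit`), and `[q, m'] ⊆ closure Ω ∩ C' ⊆ K` joins the
bad point `q` to `C_y` — contradiction.
-/

noncomputable section

namespace Summit.CriticalPhenomena.CardyFormulaZ2.Cruxes.VoronoiHubFromSmirnov.MoebiusExactDelaunayDilationWard

open scoped Topology
open Set Metric Filter
open Literature.Probability.RandomPlanarGeometry
open Literature.Topology.PlaneTopology

/-! ### Four elementary plane-geometric facts -/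

/-- Near a point `m`, a finite family of closed sets is met only in members containing `m`. -/
theorem exists_pos_forall_mem_of_finite_isClosed {𝒞 : Set (Set ℂ)} (h𝒞 : 𝒞.Finite)
    (hcl : ∀ C ∈ 𝒞, IsClosed C) (m : ℂ) :
    ∃ ρ > 0, ∀ C ∈ 𝒞, ∀ v ∈ C, dist v m < ρ → m ∈ C := by
  set U : Set ℂ := ⋂ C ∈ {C ∈ 𝒞 | m ∉ C}, Cᶜ with hU
  have hUo : IsOpen U :=
    (h𝒞.subset (sep_subset _ _)).isOpen_biInter fun C hC => (hcl C hC.1).isOpen_compl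
  have hmU : m ∈ U := mem_iInter₂.2 fun C hC => hC.2
  obtain ⟨ρ, hρ, hball⟩ := Metric.isOpen_iff.1 hUo m hmU
  refine ⟨ρ, hρ, fun C hC v hv hvm => ?_⟩
  by_contra hmC
  exact (mem_iInter₂.1 (hball (mem_ball.2 hvm)) C ⟨hC, hmC⟩) hv

/-- `closure Ω ∩ ⋃₀ 𝒞` is connected im kleinen at every point `u` of `Ω` (vacuously off `⋃₀ 𝒞`): a
small ball about `u` lies in `Ω` and meets only cells containing `u`, so segments from `u` to nearby
points of the set stay in the set. -/
theorem isCIKAt_inter_sUnion_of_mem (Ω : JordanDomain) {𝒞 : Set (Set ℂ)} (h𝒞 : 𝒞.Finite)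
    (hC : ∀ C ∈ 𝒞, IsClosed C ∧ Convex ℝ C) {u : ℂ} (huΩ : u ∈ Ω.carrier) :
    IsCIKAt (closure Ω.carrier ∩ ⋃₀ 𝒞) u := by
  intro r hr
  obtain ⟨ρ₁, hρ₁, hmem⟩ := exists_pos_forall_mem_of_finite_isClosed h𝒞 (fun C hC' => (hC C hC').1) u
  obtain ⟨ρ₂, hρ₂, hballΩ⟩ := Metric.isOpen_iff.1 Ω.isOpen u huΩ
  have hρ : 0 < min r (min ρ₁ ρ₂) := lt_min hr (lt_min hρ₁ hρ₂)
  refine ⟨min r (min ρ₁ ρ₂), hρ, fun v hv => ?_⟩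
  obtain ⟨⟨-, C, hC𝒞, hvC⟩, hvball⟩ := hv
  have hvd : dist v u < min r (min ρ₁ ρ₂) := mem_ball.1 hvball
  have huC : u ∈ C :=
    hmem C hC𝒞 v hvC (hvd.trans_le ((min_le_right _ _).trans (min_le_left _ _)))
  have hseg_ball : segment ℝ u v ⊆ ball u (min r (min ρ₁ ρ₂)) :=
    (convex_ball u _).segment_subset (mem_ball_self hρ) hvball
  have hsegK : segment ℝ u v ⊆ (closure Ω.carrier ∩ ⋃₀ 𝒞) ∩ ball u r := by
    intro w hw
    have hwb := hseg_ball hw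
    refine ⟨⟨subset_closure (hballΩ ?_), C, hC𝒞, (hC C hC𝒞).2.segment_subset huC hvC hw⟩,
      ball_subset_ball (min_le_left _ _) hwb⟩
    exact ball_subset_ball ((min_le_right _ _).trans (min_le_right _ _)) hwb
  exact (convex_segment u v).isPreconnected.subset_connectedComponentIn (left_mem_segment ℝ u v)
    hsegK (right_mem_segment ℝ u v)

/-- **First exit of a segment from an open set.** If `q ∈ U` (open) and `m ∉ U`, the moving point
`q + t (m - q)` first leaves `U` at a parameter `t ∈ [0, 1]` where it lies on `frontier U`, the
initial piece `t' ≤ t` staying in `closure U`. -/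
theorem segment_exists_first_exit {U : Set ℂ} (hU : IsOpen U) {q m : ℂ} (hq : q ∈ U) (hm : m ∉ U) :
    ∃ t ∈ Icc (0:ℝ) 1, q + t • (m - q) ∈ frontier U ∧
      ∀ s ∈ Icc (0:ℝ) t, q + s • (m - q) ∈ closure U := by
  set f : ℝ → ℂ := fun s => q + s • (m - q) with hf
  have hfc : Continuous f := by rw [hf]; fun_prop
  have hf1 : f 1 = m := by simp [hf]
  set S : Set ℝ := Icc 0 1 ∩ f ⁻¹' Uᶜ with hS
  have hSc : IsClosed S := isClosed_Icc.inter (hU.isClosed_compl.preimage hfc)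
  have h1S : (1:ℝ) ∈ S := ⟨⟨zero_le_one, le_rfl⟩, show f 1 ∈ Uᶜ by rw [hf1]; exact hm⟩
  have hSbdd : BddBelow S := ⟨0, fun s hs => hs.1.1⟩
  set t := sInf S with ht
  have htS : t ∈ S := hSc.csInf_mem ⟨1, h1S⟩ hSbdd
  have ht1 : t ≤ 1 := csInf_le hSbdd h1S
  have ht0 : 0 ≤ t := htS.1.1
  have hbelow : ∀ s, 0 ≤ s → s < t → f s ∈ U := by
    intro s hs0 hst
    by_contra hsU
    exact (csInf_le hSbdd ⟨⟨hs0, hst.le.trans ht1⟩, hsU⟩).not_gt hst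
  have htpos : 0 < t := by
    refine ht0.lt_of_ne fun h => ?_
    have h0 : f t ∈ Uᶜ := htS.2
    rw [← h] at h0
    exact h0 (by simp [hf, hq])
  have htcl : f t ∈ closure U := by
    have htc : t ∈ closure (Ico 0 t) := by rw [closure_Ico htpos.ne]; exact right_mem_Icc.2 ht0
    exact map_mem_closure hfc htc fun s hs => hbelow s hs.1 hs.2
  refine ⟨t, ⟨ht0, ht1⟩, ?_, fun s hs => ?_⟩
  · rw [hU.frontier_eq]
    exact ⟨htcl, htS.2⟩
  · rcases hs.2.lt_or_eq with h | h
    · exact subset_closure (hbelow s hs.1 h)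
    · exact h ▸ htcl

/-- **A non-degenerate sub-continuum of the boundary Jordan curve has non-empty interior in the
curve**: if `N ⊆ ∂Ω` is closed, preconnected and has two points, some ball about a point of `N`
meets `∂Ω` only inside `N` (the parameter set of `N` on a period based at a point off `N` contains
a non-degenerate interval, else `N` splits; the image of the rest of the period is a compact set
missing the image of the midpoint). -/
theorem exists_ball_inter_frontier_subset (Ω : JordanDomain) {N : Set ℂ}
    (hNJ : N ⊆ frontier Ω.carrier) (hNc : IsClosed N) (hNconn : IsPreconnected N)
    {a b : ℂ} (ha : a ∈ N) (hb : b ∈ N) (hab : a ≠ b) :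
    ∃ m ∈ N, ∃ r > 0, frontier Ω.carrier ∩ ball m r ⊆ N := by
  by_cases hJN : frontier Ω.carrier ⊆ N
  · exact ⟨a, ha, 1, one_pos, fun p hp => hJN hp.1⟩
  obtain ⟨p₀, hp₀J, hp₀N⟩ := not_subset.1 hJN
  have hp₀r : p₀ ∈ range Ω.boundary := by rwa [Ω.range_boundary]
  obtain ⟨t₀, rfl⟩ := hp₀r
  have hγc : Continuous Ω.boundary := Ω.continuous_boundary
  have hinj : InjOn Ω.boundary (Ico t₀ (t₀ + 1)) := Ω.injOn_boundary_Ico t₀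
  have hγ1 : Ω.boundary (t₀ + 1) = Ω.boundary t₀ := Ω.periodic_boundary t₀
  have hpar : ∀ p ∈ frontier Ω.carrier, ∃ t ∈ Ico t₀ (t₀ + 1), Ω.boundary t = p := by
    intro p hp
    rw [← Ω.range_boundary] at hp
    obtain ⟨s, rfl⟩ := hp
    obtain ⟨t, ht, hts⟩ := Ω.periodic_boundary.exists_mem_Ico one_pos s t₀
    exact ⟨t, ht, hts.symm⟩
  -- the parameter set of `N` in the period `[t₀, t₀ + 1]`
  set I : Set ℝ := Icc t₀ (t₀ + 1) ∩ Ω.boundary ⁻¹' N with hI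
  have hIc : IsCompact I := isCompact_Icc.inter_right (hNc.preimage hγc)
  have hI_Ioo : ∀ t ∈ I, t₀ < t ∧ t < t₀ + 1 := by
    intro t ht
    refine ⟨lt_of_le_of_ne ht.1.1 ?_, lt_of_le_of_ne ht.1.2 ?_⟩
    · rintro rfl; exact hp₀N ht.2
    · rintro rfl
      exact hp₀N (hγ1 ▸ (ht.2 : Ω.boundary (t₀ + 1) ∈ N))
  have hI_Ico : ∀ t ∈ I, t ∈ Ico t₀ (t₀ + 1) := fun t ht => ⟨ht.1.1, (hI_Ioo t ht).2⟩
  have hNI : ∀ p ∈ N, ∃ t ∈ I, Ω.boundary t = p := by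
    intro p hp
    obtain ⟨t, ht, rfl⟩ := hpar p (hNJ hp)
    exact ⟨t, ⟨Ico_subset_Icc_self ht, hp⟩, rfl⟩
  -- `I` contains a non-degenerate interval, else `N` splits into two disjoint compact pieces
  have hint : ∃ c d, c < d ∧ Icc c d ⊆ I := by
    by_contra hno
    have key : ∀ s₁ s₂, s₁ ∈ I → s₂ ∈ I → s₁ < s₂ → False := by
      intro s₁ s₂ hs₁ hs₂ hlt
      obtain ⟨e, he, heI⟩ := not_subset.1 (fun hsub => hno ⟨s₁, s₂, hlt, hsub⟩)
      have hes₁ : s₁ < e := lt_of_le_of_ne he.1 (by rintro rfl; exact heI hs₁)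
      have hes₂ : e < s₂ := lt_of_le_of_ne he.2 (by rintro rfl; exact heI hs₂)
      have hI₁c : IsClosed (Ω.boundary '' (I ∩ Iic e)) :=
        ((hIc.inter_right isClosed_Iic).image hγc).isClosed
      have hI₂c : IsClosed (Ω.boundary '' (I ∩ Ici e)) :=
        ((hIc.inter_right isClosed_Ici).image hγc).isClosed
      have hcover : N ⊆ Ω.boundary '' (I ∩ Iic e) ∪ Ω.boundary '' (I ∩ Ici e) := by
        intro p hp
        obtain ⟨t, ht, rfl⟩ := hNI p hp
        rcases le_total t e with h | h
        · exact Or.inl ⟨t, ⟨ht, h⟩, rfl⟩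
        · exact Or.inr ⟨t, ⟨ht, h⟩, rfl⟩
      obtain ⟨p, -, ⟨t₁, ht₁, rfl⟩, ⟨t₂, ht₂, h⟩⟩ := (isPreconnected_closed_iff.1 hNconn) _ _
        hI₁c hI₂c hcover ⟨_, hs₁.2, s₁, ⟨hs₁, hes₁.le⟩, rfl⟩ ⟨_, hs₂.2, s₂, ⟨hs₂, hes₂.le⟩, rfl⟩
      have h12 : t₂ = t₁ := hinj (hI_Ico t₂ ht₂.1) (hI_Ico t₁ ht₁.1) h
      have hte : t₁ = e := le_antisymm ht₁.2 (h12 ▸ ht₂.2)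
      exact heI (hte ▸ ht₁.1)
    obtain ⟨sa, hsa, rfl⟩ := hNI a ha
    obtain ⟨sb, hsb, rfl⟩ := hNI b hb
    have hne : sa ≠ sb := fun h => hab (by rw [h])
    rcases hne.lt_or_gt with h | h
    · exact key sa sb hsa hsb h
    · exact key sb sa hsb hsa h
  obtain ⟨c, d, hcd, hcdI⟩ := hint
  have hcI : c ∈ I := hcdI (left_mem_Icc.2 hcd.le)
  have hdI : d ∈ I := hcdI (right_mem_Icc.2 hcd.le)
  set tm : ℝ := (c + d) / 2 with htm
  have hctm : c < tm := by rw [htm]; linarith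
  have htmd : tm < d := by rw [htm]; linarith
  have htmI : tm ∈ I := hcdI ⟨hctm.le, htmd.le⟩
  refine ⟨Ω.boundary tm, htmI.2, ?_⟩
  -- the rest of the curve is a compact set missing `Ω.boundary tm`
  set L : Set ℂ := Ω.boundary '' (Icc t₀ c ∪ Icc d (t₀ + 1)) with hL
  have hLc : IsClosed L := ((isCompact_Icc.union isCompact_Icc).image hγc).isClosed
  have hmL : Ω.boundary tm ∉ L := by
    rintro ⟨s, hs, hsm⟩
    have hsIcc : s ∈ Icc t₀ (t₀ + 1) := by
      rcases hs with hs | hs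
      · exact ⟨hs.1, hs.2.trans (hI_Ioo c hcI).2.le⟩
      · exact ⟨(hI_Ioo d hdI).1.le.trans hs.1, hs.2⟩
    rcases hsIcc.2.lt_or_eq with hlt | heq
    · have hst : s = tm := hinj ⟨hsIcc.1, hlt⟩ (hI_Ico tm htmI) hsm
      rw [hst] at hs
      rcases hs with hs | hs
      · exact absurd hs.2 (not_le.2 hctm)
      · exact absurd hs.1 (not_le.2 htmd)
    · rw [heq, hγ1] at hsm
      exact hp₀N (hsm ▸ (htmI.2 : Ω.boundary tm ∈ N))
  obtain ⟨r, hr, hball⟩ := Metric.isOpen_iff.1 hLc.isOpen_compl (Ω.boundary tm) hmL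
  refine ⟨r, hr, fun p hp => ?_⟩
  obtain ⟨t, ht, rfl⟩ := hpar p hp.1
  have htL : Ω.boundary t ∉ L := hball hp.2
  have htc : c < t := lt_of_not_ge fun h => htL ⟨t, Or.inl ⟨ht.1, h⟩, rfl⟩
  have htd : t < d := lt_of_not_ge fun h => htL ⟨t, Or.inr ⟨h, ht.2.le⟩, rfl⟩
  exact (hcdI ⟨htc.le, htd.le⟩).2

/-! ### Components of `closure Ω ∩ ⋃₀ 𝒞` are connected im kleinen -/

/-- **Every component of `closure Ω ∩ ⋃₀ 𝒞` is connected im kleinen at each of its points**, for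
a Jordan domain `Ω` and a finite family `𝒞` of closed convex sets (see the module docstring for
the proof). -/
theorem isCIKAt_connectedComponentIn (Ω : JordanDomain) {𝒞 : Set (Set ℂ)} (h𝒞 : 𝒞.Finite)
    (hC : ∀ C ∈ 𝒞, IsClosed C ∧ Convex ℝ C) {y : ℂ}
    (hy : y ∈ closure Ω.carrier ∩ ⋃₀ 𝒞) :
    IsCIKAt (connectedComponentIn (closure Ω.carrier ∩ ⋃₀ 𝒞) y) y := by
  set K : Set ℂ := closure Ω.carrier ∩ ⋃₀ 𝒞 with hK
  -- `K` is compact, the component `M` of `y` is a continuum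
  have hPcl : IsClosed (⋃₀ 𝒞) := by
    rw [sUnion_eq_biUnion]
    exact h𝒞.isClosed_biUnion fun C hC' => (hC C hC').1
  have hKc : IsCompact K := Ω.isBounded.isCompact_closure.inter_right hPcl
  set M : Set ℂ := connectedComponentIn K y with hM
  have hMK : M ⊆ K := connectedComponentIn_subset _ _
  have hMconn : IsPreconnected M := isPreconnected_connectedComponentIn
  have hyM : y ∈ M := mem_connectedComponentIn hy
  have hMcl : IsClosed M :=
    closure_subset_iff_isClosed.1 (hMconn.closure.subset_connectedComponentIn
      (subset_closure hyM) ((closure_mono hMK).trans hKc.isClosed.closure_subset))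
  have hMc : IsCompact M := hKc.of_isClosed_subset hMcl hMK
  by_contra hnot
  simp only [IsCIKAt, not_forall, not_exists, exists_prop, not_and] at hnot
  obtain ⟨ε, hε, hbadε⟩ := hnot
  set comp : Set ℂ := connectedComponentIn (M ∩ ball y ε) y with hcomp
  -- preconnected subsets of `K ∩ B(y, ε)` through `y` lie in `comp`
  have absorb : ∀ T : Set ℂ, T ⊆ K → T ⊆ ball y ε → IsPreconnected T → y ∈ T → T ⊆ comp := by
    intro T hTK hTb hTc hyT
    have hTM : T ⊆ M := hTc.subset_connectedComponentIn hyT hTK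
    exact hTc.subset_connectedComponentIn hyT (subset_inter hTM hTb)
  set e : ℝ := ε / 2 with he
  have hepos : 0 < e := by positivity
  have heε : e < ε := by rw [he]; linarith
  -- `M` leaves the closed ball of radius `e`
  have hfar : ∃ y₀ ∈ M, e < dist y₀ y := by
    by_contra hfar
    have hMb : M ⊆ ball y ε := fun v hv =>
      mem_ball.2 ((not_lt.1 fun h => hfar ⟨v, hv, h⟩).trans_lt heε)
    exact hbadε 1 one_pos (inter_subset_left.trans (absorb M hMK hMb hMconn hyM))
  set F : Set ℂ := M ∩ closedBall y e with hF
  have hFc : IsCompact F := hMc.inter_right isClosed_closedBall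
  have hFK : F ⊆ K := inter_subset_left.trans hMK
  have hFb : F ⊆ ball y ε := fun v hv => closedBall_subset_ball heε hv.2
  have hyF : y ∈ F := ⟨hyM, mem_closedBall_self hepos.le⟩
  set Cy : Set ℂ := connectedComponentIn F y with hCy
  have hCyF : Cy ⊆ F := connectedComponentIn_subset _ _
  have hyCy : y ∈ Cy := mem_connectedComponentIn hyF
  have hCycomp : Cy ⊆ comp :=
    absorb Cy (hCyF.trans hFK) (hCyF.trans hFb) isPreconnected_connectedComponentIn hyCy
  -- KEY: no preconnected `S ⊆ K ∩ B(y, ε)` through a point of `Cy` contains a point off `comp`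
  have key : ∀ u ∈ Cy, ∀ S : Set ℂ, S ⊆ K → S ⊆ ball y ε → IsPreconnected S → u ∈ S →
      ∀ q ∈ S, q ∈ comp := by
    intro u hu S hSK hSb hSc huS q hqS
    have hT := absorb (S ∪ Cy) (union_subset hSK (hCyF.trans hFK))
      (union_subset hSb (hCyF.trans hFb))
      (IsPreconnected.union u huS hu hSc isPreconnected_connectedComponentIn) (Or.inr hyCy)
    exact hT (Or.inl hqS)
  -- bad points `yₖ → y` off `comp`, their components `Qₖ` in `F`
  have hbad : ∀ n : ℕ, ∃ q ∈ M, dist q y < min (1 / ((n : ℝ) + 1)) e ∧ q ∉ comp := by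
    intro n
    have hδ : 0 < min (1 / ((n : ℝ) + 1)) e := lt_min (by positivity) hepos
    have h1 := hbadε _ hδ
    rw [not_subset] at h1
    obtain ⟨q, ⟨hqM, hqb⟩, hqc⟩ := h1
    exact ⟨q, hqM, mem_ball.1 hqb, hqc⟩
  choose yk hykM hykd hykc using hbad
  have hyp : Tendsto yk atTop (𝓝 y) := by
    rw [tendsto_iff_dist_tendsto_zero]
    exact squeeze_zero (fun n => dist_nonneg)
      (fun n => ((hykd n).trans_le (min_le_left _ _)).le) tendsto_one_div_add_atTop_nhds_zero_nat
  have hykF : ∀ n, yk n ∈ F := fun n =>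
    ⟨hykM n, mem_closedBall.2 ((hykd n).le.trans (min_le_right _ _))⟩
  set Q : ℕ → Set ℂ := fun n => connectedComponentIn F (yk n) with hQ
  have hykQ : ∀ n, yk n ∈ Q n := fun n => mem_connectedComponentIn (hykF n)
  have hQF : ∀ n, Q n ⊆ F := fun n => connectedComponentIn_subset _ _
  have hQbad : ∀ n, ∀ q ∈ Q n, q ∉ comp := by
    intro n q hq hqc
    have h1 : Q n ⊆ connectedComponentIn (M ∩ ball y ε) q :=
      isPreconnected_connectedComponentIn.subset_connectedComponentIn hq
        (subset_inter ((hQF n).trans inter_subset_left) ((hQF n).trans hFb))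
    rw [← connectedComponentIn_eq hqc] at h1
    exact hykc n (h1 (hykQ n))
  -- boundary bumping: `Qₖ` reaches the sphere of radius `e`
  have hz : ∀ n, ∃ z ∈ Q n, dist z y = e := fun n =>
    exists_mem_connectedComponentIn_sphere hMc hMconn (hykM n)
      ((hykd n).le.trans (min_le_right _ _)) hfar
  choose z hzQ hzd using hz
  -- the convergence continuum `N = Ls Qₖ ∋ y`, inside `Cy`, non-degenerate
  set N : Set ℂ := seqLimsup Q with hN
  have hyN : y ∈ N := mem_seqLimsup_of_tendsto hykQ hyp
  have hNF : N ⊆ F := seqLimsup_subset hFc.isClosed hQF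
  have hNconn : IsPreconnected N :=
    isPreconnected_seqLimsup (fun n => isPreconnected_connectedComponentIn) hFc hQF hykQ hyp
  have hNcl : IsClosed N := isClosed_seqLimsup
  have hNCy : N ⊆ Cy := hNconn.subset_connectedComponentIn hyN hNF
  obtain ⟨z₀, -, ψ, hψ, hconv⟩ := hFc.tendsto_subseq (x := z) fun n => hQF n (hzQ n)
  have hz₀N : z₀ ∈ N := mem_seqLimsup_of_subseq hψ (y := z ∘ ψ) (fun k => hzQ (ψ k)) hconv
  have hz₀d : dist z₀ y = e := by
    have h1 : Tendsto (fun k => dist ((z ∘ ψ) k) y) atTop (𝓝 (dist z₀ y)) :=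
      (continuous_id.dist continuous_const).continuousAt.tendsto.comp hconv
    have h2 : (fun k => dist ((z ∘ ψ) k) y) = fun _ => e := funext fun k => hzd (ψ k)
    rw [h2] at h1
    exact tendsto_nhds_unique h1 tendsto_const_nhds
  have hz₀y : z₀ ≠ y := by
    intro h
    rw [h, dist_self] at hz₀d
    exact hepos.ne hz₀d
  -- Step 1: `N` misses `Ω` (there `K` is connected im kleinen)
  have hNΩ : ∀ u ∈ N, u ∉ Ω.carrier := by
    intro u huN huΩ
    have huK : u ∈ K := hFK (hNF huN)
    obtain ⟨ρ, hρ, hsub⟩ := isCIKAt_inter_sUnion_of_mem Ω h𝒞 hC huΩ e hepos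
    obtain ⟨n, q, hqQ, hqu⟩ := (huN ρ hρ).exists
    have hqS : q ∈ connectedComponentIn (K ∩ ball u e) u := hsub ⟨hFK (hQF n hqQ), hqu⟩
    have hSb : connectedComponentIn (K ∩ ball u e) u ⊆ ball y ε := by
      intro v hv
      have hv' : dist v u < e := mem_ball.1 (connectedComponentIn_subset _ _ hv).2
      have huy : dist u y ≤ e := mem_closedBall.1 (hNF huN).2
      rw [mem_ball]
      calc dist v y ≤ dist v u + dist u y := dist_triangle _ _ _
        _ < e + e := add_lt_add_of_lt_of_le hv' huy
        _ = ε := by rw [he]; ring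
    exact hQbad n q hqQ (key u (hNCy huN) _
      ((connectedComponentIn_subset _ _).trans inter_subset_left) hSb
      isPreconnected_connectedComponentIn (mem_connectedComponentIn ⟨huK, mem_ball_self hepos⟩)
      q hqS)
  have hNJ : N ⊆ frontier Ω.carrier := by
    intro u huN
    have hucl : u ∈ closure Ω.carrier := (hFK (hNF huN)).1
    rw [closure_eq_self_union_frontier] at hucl
    exact hucl.resolve_left (hNΩ u huN)
  -- Step 2: a point `m` of `N` about which the Jordan curve lies in `N`
  obtain ⟨m, hmN, r, hr, hJr⟩ :=
    exists_ball_inter_frontier_subset Ω hNJ hNcl hNconn hz₀N hyN hz₀y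
  -- Step 3: a bad point `q ∈ Ω` near `m`, in a cell `C' ∋ m`; the segment `[q, m]` first leaves
  -- `Ω` at a point of `N`, joining `q` to `Cy` inside `K ∩ B(y, ε)` — contradiction
  obtain ⟨ρ₁, hρ₁, hmem⟩ := exists_pos_forall_mem_of_finite_isClosed h𝒞 (fun C hC' => (hC C hC').1) m
  obtain ⟨n, q, hqQ, hqm⟩ := (hmN (min r ρ₁) (lt_min hr hρ₁)).exists
  have hqF : q ∈ F := hQF n hqQ
  have hqK : q ∈ K := hFK hqF
  have hqr : q ∈ ball m r := ball_subset_ball (min_le_left _ _) hqm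
  have hqbad : q ∉ comp := hQbad n q hqQ
  have hqΩ : q ∈ Ω.carrier := by
    have hqcl : q ∈ closure Ω.carrier := hqK.1
    rw [closure_eq_self_union_frontier] at hqcl
    exact hqcl.resolve_right fun hqJ => hqbad (hCycomp (hNCy (hJr ⟨hqJ, hqr⟩)))
  obtain ⟨C', hC'𝒞, hqC'⟩ := hqK.2
  have hmC' : m ∈ C' :=
    hmem C' hC'𝒞 q hqC' (mem_ball.1 (ball_subset_ball (min_le_right _ _) hqm))
  obtain ⟨t, ht, htfr, hcl⟩ := segment_exists_first_exit Ω.isOpen hqΩ (hNΩ m hmN)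
  have hfseg : ∀ s ∈ Icc (0:ℝ) t, q + s • (m - q) ∈ segment ℝ q m := by
    intro s hs
    rw [segment_eq_image' ℝ q m]
    exact ⟨s, ⟨hs.1, hs.2.trans ht.2⟩, rfl⟩
  have hSK : (fun s : ℝ => q + s • (m - q)) '' Icc 0 t ⊆ K := by
    rintro _ ⟨s, hs, rfl⟩
    exact ⟨hcl s hs, C', hC'𝒞, (hC C' hC'𝒞).2.segment_subset hqC' hmC' (hfseg s hs)⟩
  have hSb : (fun s : ℝ => q + s • (m - q)) '' Icc 0 t ⊆ ball y ε := by
    rintro _ ⟨s, hs, rfl⟩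
    exact closedBall_subset_ball heε
      ((convex_closedBall y e).segment_subset hqF.2 (hNF hmN).2 (hfseg s hs))
  have hSc : IsPreconnected ((fun s : ℝ => q + s • (m - q)) '' Icc 0 t) :=
    isPreconnected_Icc.image _ (by fun_prop : Continuous fun s : ℝ => q + s • (m - q)).continuousOn
  have hm' : q + t • (m - q) ∈ N :=
    hJr ⟨htfr, (convex_ball m r).segment_subset hqr (mem_ball_self hr) (hfseg t ⟨ht.1, le_rfl⟩)⟩
  have hq0 : q ∈ (fun s : ℝ => q + s • (m - q)) '' Icc 0 t := ⟨0, ⟨le_rfl, ht.1⟩, by simp⟩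
  exact hqbad (key _ (hNCy hm') _ hSK hSb hSc ⟨t, ⟨ht.1, le_rfl⟩, rfl⟩ q hq0)

/-- **S0′b** — components of a closed Jordan disc cut by finitely many closed convex bodies are
connected im kleinen at each of their points (`isCIKAt_connectedComponentIn`, after rewriting the
component of `x` as the component of its point `y`). -/
theorem stub_componentsCIK : Sig.stub_componentsCIK := by
  intro Ω 𝒞 h𝒞 hC x _ y hy ε hε
  have hyK : y ∈ closure Ω.carrier ∩ ⋃₀ 𝒞 := connectedComponentIn_subset _ _ hy
  rw [connectedComponentIn_eq hy]
  exact isCIKAt_connectedComponentIn Ω h𝒞 (fun C hC' => ⟨(hC C hC').1, (hC C hC').2.1⟩) hyK ε hε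

end Summit.CriticalPhenomena.CardyFormulaZ2.Cruxes.VoronoiHubFromSmirnov.MoebiusExactDelaunayDilationWard

end
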